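import Summits.CriticalPhenomena.PercolationContinuityZ3.Theorems.SahiMasterFamilyPointwiseStrata
import Summits.CriticalPhenomena.PercolationContinuityZ3.Theorems.SahiMasterFamilyFaceVanishingC3

/-!
# (M⁺-3) — hence the POINTWISE master equality conjecture (EQ-3) — on every FACE-VANISHING triple

Unit `prim-master-conj` (crux anchor stmt-CriticalPhenomena-4575, helper work), gen 13; companion of `SahiMasterFamilyPointwise.lean` /
`SahiMasterFamilyPointwiseStrata.lean`.  A triple of increasing events determined by `S` is FACE-VANISHING if every one-coordinate
minor at a coordinate of `S` is a zero flag (`Z₃`).  Seat P4 proved Kahn's Conjecture 5 on this class at the LAW level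
(`sahiE_three_nonneg_of_faceVanishing`, `SahiMasterFamilyFaceVanishingC3`).  Re-running that case analysis with comb-positive endings —

* an independent pair: `combPos_sahiE_ind_of_zeroFlag` ((M⁺-2), law of total covariance);
* pairwise dependent with a common pivotal coordinate: the triple is tight (`PositiveSomewhere.faceVanishingCommonPivotalTight_holds`), i.e.
  principal-cap, and the principal-cap stratum is comb-positive (`Pointwise.combPos_sahiE_three_of_principalCap`, this unit);
* terminal (pairwise dependent, no common pivotal coordinate): prim-master-conj's terminal analysis ends in the TRIANGLE — three `orPair`
  events on three coordinates, a core of `≤ 3` coordinates (`SahiCombCore.combPos_sahiE_three_of_core_le_three`, standard axioms) — or in a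
  PURE event, which is a cylinder (`combPos_sahiE_three_cylinder`); `combPos_terminal_core` is `terminal_core_nonneg` verbatim with these
  endings —

gives **`combPos_sahiE_three_of_faceVanishing`: every face-vanishing triple is comb-positive, (M⁺-3)** (the coefficientwise / three-copy
fibre form of Kahn's Conjecture 5 on the class), and therefore, by `Pointwise.sahiE_ind_eq_zero_iff_of_combPos`,
**`sahiE_three_ind_eq_zero_iff_of_faceVanishing`: for `p` in the open cube, `E₃(μ_p; 1_U) = 0 ↔ U ∈ Z₃` on every face-vanishing triple**,
with the strict form `E₃(μ_p) > 0` off `Z₃` (`sahiE_three_ind_pos_of_faceVanishing`).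
HONEST FRAMING: Kahn's Conjecture 5, (M⁺-3) and (EQ-3) in general (triples with a minor outside `Z₃`) remain OPEN.  Axioms standard.
[this work]
-/

noncomputable section

open scoped Classical

namespace Summit.CriticalPhenomena.PercolationContinuityZ3.Theorems

open Finset Function
open Literature.Combinatorics.Sahi2008
open Literature.Probability.Percolation (DeterminedBy determinedBy_iff)
open Literature.Probability.Percolation.DecisionTree (ind ind_of_mem ind_of_not_mem ind_nonneg)
open Literature.Probability.LatticeModels.Kahn2022 (Affects)
open SahiComb

namespace Pointwise

/-! ### The terminal class at the comb level -/

/-- **Terminal triples are comb-positive** — `terminal_core_nonneg` (seat P4, itself gen 11's `terminal_core_pos`) re-run with comb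
endings: the triangle has a core of three coordinates, a pure event is a cylinder. [this work] -/
theorem combPos_terminal_core {ι : Type} [Fintype ι] {A B C : Set (Set ι)}
    (hA : IsUpperSet A) (hB : IsUpperSet B) (hC : IsUpperSet C)
    (hAB : (esupp A ∩ esupp B).Nonempty) (hAC : (esupp A ∩ esupp C).Nonempty) (hBC : (esupp B ∩ esupp C).Nonempty)
    (hprivA : esupp A ⊆ esupp B ∪ esupp C) (hprivB : esupp B ⊆ esupp A ∪ esupp C)
    (hprivC : esupp C ⊆ esupp A ∪ esupp B) (hcommon : ∀ i, i ∈ esupp A → i ∈ esupp B → i ∉ esupp C)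
    (hmin : ∀ i ∈ esupp A ∪ esupp B ∪ esupp C, ∀ b : Bool, SuppZeroFlag 3 ![secAt i b A, secAt i b B, secAt i b C]) :
    CombPos (fun _ : ι => 3) (fun p => sahiE (bernoulliWeight p) 3 (fun j => ind ((![A, B, C] : Fin 3 → Set (Set ι)) j))) := by
  -- basic facts
  have hU : ∀ j, IsUpperSet ((![A, B, C] : Fin 3 → Set (Set ι)) j) := by
    intro j; fin_cases j <;> assumption
  have hBA : (esupp B ∩ esupp A).Nonempty := by rwa [inter_comm]
  have hCA : (esupp C ∩ esupp A).Nonempty := by rwa [inter_comm]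
  have hCB : (esupp C ∩ esupp B).Nonempty := by rwa [inter_comm]
  have hAne : A.Nonempty := by obtain ⟨i, hi⟩ := hAB; exact (nonempty_of_esupp_nonempty ⟨i, (mem_inter.1 hi).1⟩).1
  have hBne : B.Nonempty := by obtain ⟨i, hi⟩ := hAB; exact (nonempty_of_esupp_nonempty ⟨i, (mem_inter.1 hi).2⟩).1
  have hCne : C.Nonempty := by obtain ⟨i, hi⟩ := hAC; exact (nonempty_of_esupp_nonempty ⟨i, (mem_inter.1 hi).2⟩).1
  -- permuted forms of `hcommon`, `hpriv`, `hmin`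
  have hcACB : ∀ i, i ∈ esupp A → i ∈ esupp C → i ∉ esupp B := fun i hA' hC' hB' => hcommon i hA' hB' hC'
  have hcBAC : ∀ i, i ∈ esupp B → i ∈ esupp A → i ∉ esupp C := fun i hB' hA' => hcommon i hA' hB'
  have hcBCA : ∀ i, i ∈ esupp B → i ∈ esupp C → i ∉ esupp A := fun i hB' hC' hA' => hcommon i hA' hB' hC'
  have hcCAB : ∀ i, i ∈ esupp C → i ∈ esupp A → i ∉ esupp B := fun i hC' hA' hB' => hcommon i hA' hB' hC'
  have hcCBA : ∀ i, i ∈ esupp C → i ∈ esupp B → i ∉ esupp A := fun i hC' hB' hA' => hcommon i hA' hB' hC'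
  have hpA' : esupp A ⊆ esupp C ∪ esupp B := by rwa [union_comm]
  have hpB' : esupp B ⊆ esupp C ∪ esupp A := by rwa [union_comm]
  have hpC' : esupp C ⊆ esupp B ∪ esupp A := by rwa [union_comm]
  have up : ∀ (X : Set (Set ι)) (i : ι) (b : Bool), IsUpperSet X → IsUpperSet (secAt i b X) :=
    fun X i b h => isUpperSet_secAt i b h
  have memW : ∀ {i : ι} {P Q R : Finset ι}, i ∈ P ∪ Q ∪ R → i ∈ Q ∪ P ∪ R ∧ i ∈ P ∪ R ∪ Q ∧ i ∈ R ∪ P ∪ Q ∧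
      i ∈ Q ∪ R ∪ P ∧ i ∈ R ∪ Q ∪ P := by
    intro i P Q R h; simp only [mem_union] at h ⊢; tauto
  have hmBAC : ∀ i ∈ esupp B ∪ esupp A ∪ esupp C, ∀ b : Bool,
      SuppZeroFlag 3 ![secAt i b B, secAt i b A, secAt i b C] := fun i hi b =>
    (suppZeroFlag_three_swap12 (up A i b hA) (up B i b hB) (up C i b hC)).1 (hmin i (memW hi).1 b)
  have hmACB : ∀ i ∈ esupp A ∪ esupp C ∪ esupp B, ∀ b : Bool,
      SuppZeroFlag 3 ![secAt i b A, secAt i b C, secAt i b B] := fun i hi b =>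
    (suppZeroFlag_three_swap23 (up A i b hA) (up B i b hB) (up C i b hC)).1 (hmin i (memW hi).2.1 b)
  have hmCAB : ∀ i ∈ esupp C ∪ esupp A ∪ esupp B, ∀ b : Bool,
      SuppZeroFlag 3 ![secAt i b C, secAt i b A, secAt i b B] := fun i hi b =>
    (suppZeroFlag_three_swap12 (up A i b hA) (up C i b hC) (up B i b hB)).1 (hmACB i (memW hi).1 b)
  have hmBCA : ∀ i ∈ esupp B ∪ esupp C ∪ esupp A, ∀ b : Bool,
      SuppZeroFlag 3 ![secAt i b B, secAt i b C, secAt i b A] := fun i hi b =>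
    (suppZeroFlag_three_swap23 (up B i b hB) (up A i b hA) (up C i b hC)).1 (hmBAC i (memW hi).2.1 b)
  have hmCBA : ∀ i ∈ esupp C ∪ esupp B ∪ esupp A, ∀ b : Bool,
      SuppZeroFlag 3 ![secAt i b C, secAt i b B, secAt i b A] := fun i hi b =>
    (suppZeroFlag_three_swap12 (up B i b hB) (up C i b hC) (up A i b hA)).1 (hmBCA i (memW hi).1 b)
  by_cases hsat : (∃ f ∈ esupp A, secAt f true A = Set.univ) ∨ (∃ f ∈ esupp B, secAt f true B = Set.univ) ∨
      (∃ f ∈ esupp C, secAt f true C = Set.univ)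
  · -- THE TRIANGLE
    -- the three essential supports lie in a set of three coordinates, so the core has `≤ 3` elements
    have hsub3 : ∀ {f s t : ι} {P : Finset ι}, (P = {f, s} ∨ P = {f, t} ∨ P = {s, t}) → P ⊆ ({f, s, t} : Finset ι) := by
      intro f s t P h
      rcases h with rfl | rfl | rfl <;> intro x hx <;> simp only [mem_insert, mem_singleton] at hx ⊢ <;> tauto
    suffices key : ∃ T : Finset ι, T.card ≤ 3 ∧ esupp A ⊆ T ∧ esupp B ⊆ T ∧ esupp C ⊆ T by
      obtain ⟨T, hT3, hAT, hBT, hCT⟩ := key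
      refine SahiCombCore.combPos_sahiE_three_of_core_le_three T hT3 _ hU fun e he j j' hj _ => ?_
      exfalso
      have hmem : e ∈ esupp ((![A, B, C] : Fin 3 → Set (Set ι)) j) := mem_esupp.2 hj
      fin_cases j
      · exact he (hAT hmem)
      · exact he (hBT hmem)
      · exact he (hCT hmem)
    rcases hsat with ⟨f, hf, hs⟩ | ⟨f, hf, hs⟩ | ⟨f, hf, hs⟩
    · rcases mem_union.1 (hprivA hf) with hf' | hf'
      · obtain ⟨s, t, eA, eB, eC, -, -, -⟩ :=
          triangle_of_saturation hA hB hC hAC hBC hprivA hprivB hprivC hcommon hmin hf hf' hs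
        exact ⟨{f, s, t}, Finset.card_le_three, by rw [eA]; exact hsub3 (Or.inl rfl), by rw [eB]; exact hsub3 (Or.inr (Or.inl rfl)),
          by rw [eC]; exact hsub3 (Or.inr (Or.inr rfl))⟩
      · obtain ⟨s, t, eA, eC, eB, -, -, -⟩ :=
          triangle_of_saturation hA hC hB hAB hCB hpA' hprivC hprivB hcACB hmACB hf hf' hs
        exact ⟨{f, s, t}, Finset.card_le_three, by rw [eA]; exact hsub3 (Or.inl rfl), by rw [eB]; exact hsub3 (Or.inr (Or.inr rfl)),
          by rw [eC]; exact hsub3 (Or.inr (Or.inl rfl))⟩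
    · rcases mem_union.1 (hprivB hf) with hf' | hf'
      · obtain ⟨s, t, eB, eA, eC, -, -, -⟩ :=
          triangle_of_saturation hB hA hC hBC hAC hprivB hprivA hpC' hcBAC hmBAC hf hf' hs
        exact ⟨{f, s, t}, Finset.card_le_three, by rw [eA]; exact hsub3 (Or.inr (Or.inl rfl)), by rw [eB]; exact hsub3 (Or.inl rfl),
          by rw [eC]; exact hsub3 (Or.inr (Or.inr rfl))⟩
      · obtain ⟨s, t, eB, eC, eA, -, -, -⟩ :=
          triangle_of_saturation hB hC hA hBA hCA hpB' hpC' hprivA hcBCA hmBCA hf hf' hs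
        exact ⟨{f, s, t}, Finset.card_le_three, by rw [eA]; exact hsub3 (Or.inr (Or.inr rfl)), by rw [eB]; exact hsub3 (Or.inl rfl),
          by rw [eC]; exact hsub3 (Or.inr (Or.inl rfl))⟩
    · rcases mem_union.1 (hprivC hf) with hf' | hf'
      · obtain ⟨s, t, eC, eA, eB, -, -, -⟩ :=
          triangle_of_saturation hC hA hB hCB hAB hprivC hpA' hpB' hcCAB hmCAB hf hf' hs
        exact ⟨{f, s, t}, Finset.card_le_three, by rw [eA]; exact hsub3 (Or.inr (Or.inl rfl)), by rw [eB]; exact hsub3 (Or.inr (Or.inr rfl)),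
          by rw [eC]; exact hsub3 (Or.inl rfl)⟩
      · obtain ⟨s, t, eC, eB, eA, -, -, -⟩ :=
          triangle_of_saturation hC hB hA hCA hBA hpC' hpB' hpA' hcCBA hmCBA hf hf' hs
        exact ⟨{f, s, t}, Finset.card_le_three, by rw [eA]; exact hsub3 (Or.inr (Or.inr rfl)), by rw [eB]; exact hsub3 (Or.inr (Or.inl rfl)),
          by rw [eC]; exact hsub3 (Or.inl rfl)⟩
  · -- NO SATURATION: a pure event exists, and pure events are cylinders
    simp only [not_or, not_exists, not_and] at hsat
    obtain ⟨nsA, nsB, nsC⟩ := hsat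
    have hNSA : ∀ s ∈ esupp A, ({s} : Set ι) ∉ A := fun s hs h => nsA s hs ((secAt_true_eq_univ_iff' hA s).2 h)
    have hNSB : ∀ s ∈ esupp B, ({s} : Set ι) ∉ B := fun s hs h => nsB s hs ((secAt_true_eq_univ_iff' hB s).2 h)
    have hNSC : ∀ s ∈ esupp C, ({s} : Set ι) ∉ C := fun s hs h => nsC s hs ((secAt_true_eq_univ_iff' hC s).2 h)
    have hpure : (∀ f ∈ esupp A, secAt f false A = ∅) ∨ (∀ f ∈ esupp B, secAt f false B = ∅) ∨
        (∀ f ∈ esupp C, secAt f false C = ∅) := by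
      by_cases hN0AB : ∃ e ∈ esupp A ∩ esupp B, Set.univ \ {e} ∈ A ∧ Set.univ \ {e} ∈ B
      · obtain ⟨e, he, h1, h2⟩ := hN0AB
        exact Or.inr (Or.inr (lemma_L3 hA hB hC hAB hAC hBC hprivA hprivB hprivC hcommon hNSA hNSB hNSC hmin
          (mem_inter.1 he).1 (mem_inter.1 he).2 h1 h2))
      by_cases hN0AC : ∃ e ∈ esupp A ∩ esupp C, Set.univ \ {e} ∈ A ∧ Set.univ \ {e} ∈ C
      · obtain ⟨e, he, h1, h2⟩ := hN0AC
        exact Or.inr (Or.inl (lemma_L3 hA hC hB hAC hAB hCB hpA' hprivC hprivB hcACB hNSA hNSC hNSB hmACB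
          (mem_inter.1 he).1 (mem_inter.1 he).2 h1 h2))
      by_cases hN0BC : ∃ e ∈ esupp B ∩ esupp C, Set.univ \ {e} ∈ B ∧ Set.univ \ {e} ∈ C
      · obtain ⟨e, he, h1, h2⟩ := hN0BC
        exact Or.inl (lemma_L3 hB hC hA hBC hBA hCA hpB' hpC' hprivA hcBCA hNSB hNSC hNSA hmBCA
          (mem_inter.1 he).1 (mem_inter.1 he).2 h1 h2)
      -- every shared coordinate is mandatory for exactly one of its events
      have gtype : ∀ {X Y Z : Set (Set ι)}, IsUpperSet X → IsUpperSet Y → IsUpperSet Z →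
          X.Nonempty → Y.Nonempty → Z.Nonempty → (esupp X ∩ esupp Z).Nonempty →
          (∀ i, i ∈ esupp X → i ∈ esupp Y → i ∉ esupp Z) → (∀ i, i ∈ esupp X → i ∈ esupp Z → i ∉ esupp Y) →
          (∀ i ∈ esupp X ∪ esupp Y ∪ esupp Z, ∀ b : Bool, SuppZeroFlag 3 ![secAt i b X, secAt i b Y, secAt i b Z]) →
          (¬ ∃ e ∈ esupp X ∩ esupp Y, Set.univ \ {e} ∈ X ∧ Set.univ \ {e} ∈ Y) →
          ∀ f, f ∈ esupp X → f ∈ esupp Y → (secAt f false X = ∅ ↔ secAt f false Y ≠ ∅) := by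
        intro X Y Z hX hY hZ hXne hYne hZne hXZ hcXYZ hcXZY hm hN0 f hfX hfY
        constructor
        · intro hmX hmY
          obtain ⟨s, hs⟩ := hXZ
          have hsX := (mem_inter.1 hs).1
          have hsZ := (mem_inter.1 hs).2
          have hse : s ≠ f := fun h => hcXYZ f hfX hfY (h ▸ hsZ)
          exact lemma_L2 hX hY hZ hXne hYne hZne hse hfY (hcXYZ f hfX hfY) (hcXZY s hsX hsZ) hmX hmY
            (hm s (by simp [hsX]) true)
        · intro hmY
          by_contra hmX
          refine hN0 ⟨f, mem_inter.2 ⟨hfX, hfY⟩, ?_, ?_⟩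
          · by_contra h; exact hmX ((secAt_false_eq_empty_iff hX f).2 h)
          · by_contra h; exact hmY ((secAt_false_eq_empty_iff hY f).2 h)
      have hGAB := gtype hA hB hC hAne hBne hCne hAC hcommon hcACB hmin hN0AB
      have hGAC := gtype hA hC hB hAne hCne hBne hAB hcACB hcommon hmACB hN0AC
      have hGBC := gtype hB hC hA hBne hCne hAne hBA hcBCA hcBAC hmBCA hN0BC
      exact stepA hA hB hC hAne hBne hCne hAB hAC hBC hprivA hprivB hprivC hcommon (fun i hi => hmin i hi true)
        hGAB hGAC hGBC
    -- a pure event is a cylinder; the cylinder stratum is comb-positive (`combPos_sahiE_three_cylinder`)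
    rcases hpure with h | h | h
    · exact combPos_sahiE_three_cylinder _ hU 0 _ (eq_cylinder_of_pure hA hAne h)
    · exact combPos_sahiE_three_cylinder _ hU 1 _ (eq_cylinder_of_pure hB hBne h)
    · exact combPos_sahiE_three_cylinder _ hU 2 _ (eq_cylinder_of_pure hC hCne h)

/-- **(M⁺-3) on the terminal class**: every terminal triple of increasing events (pairwise dependent, no common pivotal coordinate, all
minors zero flags) has `p ↦ E₃(μ_p; 1_U)` comb-positive at multidegree `3`. [this work] -/
theorem combPos_sahiE_three_of_terminal {ι : Type} [Fintype ι] (U : Fin 3 → Set (Set ι)) (S : Finset ι)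
    (hU : ∀ j, IsUpperSet (U j)) (hUS : ∀ j, DeterminedBy (U j) (↑S : Set ι)) (hT : TerminalTriple U S) :
    CombPos (fun _ : ι => 3) (fun p => sahiE (bernoulliWeight p) 3 (fun j => ind (U j))) := by
  obtain ⟨hPD, hnc, hmin⟩ := hT
  have hT' : TerminalTriple U S := ⟨hPD, hnc, hmin⟩
  -- pairwise-intersecting essential supports
  have hdep : ∀ {X Y : Set (Set ι)}, IsUpperSet X → IsUpperSet Y → ¬ SuppZeroFlag 2 ![X, Y] →
      (esupp X ∩ esupp Y).Nonempty := by
    intro X Y hX hY h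
    by_contra hne
    rw [Finset.not_nonempty_iff_eq_empty] at hne
    exact h ((suppZeroFlag_two_iff hX hY).2 (Finset.disjoint_iff_inter_eq_empty.2 hne))
  have e12 : (fun j : Fin 2 => U ((0 : Fin 3).succAbove j)) = ![U 1, U 2] := by funext j; fin_cases j <;> rfl
  have e02 : (fun j : Fin 2 => U ((1 : Fin 3).succAbove j)) = ![U 0, U 2] := by funext j; fin_cases j <;> rfl
  have e01 : (fun j : Fin 2 => U ((2 : Fin 3).succAbove j)) = ![U 0, U 1] := by funext j; fin_cases j <;> rfl
  have h12 := hPD 0; rw [e12] at h12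
  have h02 := hPD 1; rw [e02] at h02
  have h01 := hPD 2; rw [e01] at h01
  have hAB := hdep (hU 0) (hU 1) h01
  have hAC := hdep (hU 0) (hU 2) h02
  have hBC := hdep (hU 1) (hU 2) h12
  -- no common coordinate
  have hcommon : ∀ i, i ∈ esupp (U 0) → i ∈ esupp (U 1) → i ∉ esupp (U 2) := by
    intro i h0 h1 h2
    refine hnc ⟨i, fun j => ?_⟩
    have hj : Affects (U j) i := by
      fin_cases j
      · exact mem_esupp.1 h0
      · exact mem_esupp.1 h1
      · exact mem_esupp.1 h2
    obtain ⟨ω, hω, hiω⟩ := hj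
    exact ⟨ω, fun hi => hω (by rwa [Set.insert_eq_of_mem hi] at hiω), hω, hiω⟩
  -- all minors, in matrix form
  have hsec : ∀ (e : ι) (b : Bool), (fun j => secAt e b (U j)) = ![secAt e b (U 0), secAt e b (U 1), secAt e b (U 2)] := by
    intro e b; funext j; fin_cases j <;> rfl
  have hminW : ∀ i ∈ esupp (U 0) ∪ esupp (U 1) ∪ esupp (U 2), ∀ b : Bool,
      SuppZeroFlag 3 ![secAt i b (U 0), secAt i b (U 1), secAt i b (U 2)] := by
    intro i hi b
    have hiS : i ∈ S := by
      simp only [mem_union] at hi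
      rcases hi with (hi | hi) | hi
      · exact esupp_subset_of_determinedBy (hUS 0) hi
      · exact esupp_subset_of_determinedBy (hUS 1) hi
      · exact esupp_subset_of_determinedBy (hUS 2) hi
    have := hmin i hiS b
    rwa [hsec] at this
  -- no private coordinate (Lemma P, three slots)
  have hprivA : esupp (U 0) ⊆ esupp (U 1) ∪ esupp (U 2) := esupp_subset_union_of_terminal hU hUS hT'
  have up : ∀ (j : Fin 3) (i : ι) (b : Bool), IsUpperSet (secAt i b (U j)) := fun j i b => isUpperSet_secAt i b (hU j)
  have hprivB : esupp (U 1) ⊆ esupp (U 0) ∪ esupp (U 2) := by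
    intro e he
    by_contra hnot
    rw [mem_union, not_or] at hnot
    have heS : e ∈ S := esupp_subset_of_determinedBy (hUS 1) he
    have hmin' : ∀ b : Bool, SuppZeroFlag 3 ![secAt e b (U 1), U 0, U 2] := by
      intro b
      have h := hmin e heS b
      rw [hsec, secAt_eq_self_of_not_affects (hU 0) (fun h' => hnot.1 (mem_esupp.2 h')) b,
        secAt_eq_self_of_not_affects (hU 2) (fun h' => hnot.2 (mem_esupp.2 h')) b] at h
      exact (suppZeroFlag_three_swap12 (hU 0) (up 1 e b) (hU 2)).1 h
    exact not_both_minors_zeroFlag (hU 1) (hU 0) (hU 2) (by rwa [inter_comm]) hBC hAC hnot.1 hnot.2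
      (hmin' false) (hmin' true)
  have hprivC : esupp (U 2) ⊆ esupp (U 0) ∪ esupp (U 1) := by
    intro e he
    by_contra hnot
    rw [mem_union, not_or] at hnot
    have heS : e ∈ S := esupp_subset_of_determinedBy (hUS 2) he
    have hmin' : ∀ b : Bool, SuppZeroFlag 3 ![secAt e b (U 2), U 0, U 1] := by
      intro b
      have h := hmin e heS b
      rw [hsec, secAt_eq_self_of_not_affects (hU 0) (fun h' => hnot.1 (mem_esupp.2 h')) b,
        secAt_eq_self_of_not_affects (hU 1) (fun h' => hnot.2 (mem_esupp.2 h')) b] at h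
      exact (suppZeroFlag_three_swap12 (hU 0) (up 2 e b) (hU 1)).1
        ((suppZeroFlag_three_swap23 (hU 0) (hU 1) (up 2 e b)).1 h)
    exact not_both_minors_zeroFlag (hU 2) (hU 0) (hU 1) (by rwa [inter_comm]) (by rwa [inter_comm]) hAB hnot.1
      hnot.2 (hmin' false) (hmin' true)
  -- the core
  have hF : (fun j => ind (U j)) = fun j => ind ((![U 0, U 1, U 2] : Fin 3 → Set (Set ι)) j) := by
    funext j; fin_cases j <;> rfl
  rw [hF]
  exact combPos_terminal_core (hU 0) (hU 1) (hU 2) hAB hAC hBC hprivA hprivB hprivC hcommon hminW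

/-! ### Face-vanishing triples -/

/-- **(M⁺-3) on face-vanishing triples with a common pivotal coordinate** (tightness + the principal-cap comb stratum). [this work] -/
theorem combPos_sahiE_three_of_commonPivotal_faceVanishing (ι : Type) [Fintype ι] (U : Fin 3 → Set (Set ι))
    (S : Finset ι) (hU : ∀ j, IsUpperSet (U j)) (hUS : ∀ j, DeterminedBy (U j) (↑S : Set ι))
    (hpiv : ∃ e : ι, ∀ j, ∃ ω, e ∉ ω ∧ ω ∉ U j ∧ insert e ω ∈ U j)
    (hfv : ∀ e ∈ S, ∀ b : Bool, SuppZeroFlag 3 (fun j => secAt e b (U j))) :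
    CombPos (fun _ : ι => 3) (fun p => sahiE (bernoulliWeight p) 3 (fun j => ind (U j))) := by
  obtain ⟨c, hc⟩ := PositiveSomewhere.faceVanishingCommonPivotalTight_holds ι U S hU hUS hpiv hfv
  exact combPos_sahiE_three_of_principalCap U hU c hc

/-- **(M⁺-3) ON EVERY FACE-VANISHING TRIPLE**: three increasing events determined by `S`, all of whose minors at coordinates of `S` are
zero flags, have `p ↦ E₃(μ_p; 1_{U₀},1_{U₁},1_{U₂})` a nonnegative combination of the degree-3 tensor-Bernstein basis. [this work] -/
theorem combPos_sahiE_three_of_faceVanishing (ι : Type) [Fintype ι] (U : Fin 3 → Set (Set ι))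
    (S : Finset ι) (hU : ∀ j, IsUpperSet (U j)) (hUS : ∀ j, DeterminedBy (U j) (↑S : Set ι))
    (hfv : ∀ e ∈ S, ∀ b : Bool, SuppZeroFlag 3 (fun j => secAt e b (U j))) :
    CombPos (fun _ : ι => 3) (fun p => sahiE (bernoulliWeight p) 3 (fun j => ind (U j))) := by
  by_cases hPD : PairwiseDependent U
  · by_cases hpiv : ∃ e : ι, ∀ j, ∃ ω, e ∉ ω ∧ ω ∉ U j ∧ insert e ω ∈ U j
    · exact combPos_sahiE_three_of_commonPivotal_faceVanishing ι U S hU hUS hpiv hfv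
    · exact combPos_sahiE_three_of_terminal U S hU hUS ⟨hPD, hpiv, hfv⟩
  · unfold PairwiseDependent at hPD
    push Not at hPD
    obtain ⟨m, hm⟩ := hPD
    exact combPos_sahiE_ind_of_zeroFlag masterFamilyCombPos_two U hU m hm

/-- **Pointwise (EQ-3) on every face-vanishing triple**: for `p` in the open cube, `E₃(μ_p; 1_U) = 0 ↔ U ∈ Z₃`. [this work] -/
theorem sahiE_three_ind_eq_zero_iff_of_faceVanishing (ι : Type) [Fintype ι] (p : ι → unitInterval)
    (hp : ∀ e, (p e : ℝ) ∈ Set.Ioo (0 : ℝ) 1) (U : Fin 3 → Set (Set ι)) (S : Finset ι) (hU : ∀ j, IsUpperSet (U j))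
    (hUS : ∀ j, DeterminedBy (U j) (↑S : Set ι)) (hfv : ∀ e ∈ S, ∀ b : Bool, SuppZeroFlag 3 (fun j => secAt e b (U j))) :
    sahiE (bernoulliWeight p) 3 (fun j => ind (U j)) = 0 ↔ SuppZeroFlag 3 U :=
  sahiE_ind_eq_zero_iff_of_combPos hU (combPos_sahiE_three_of_faceVanishing ι U S hU hUS hfv) hp

/-- Strict form: a face-vanishing triple outside `Z₃` has `E₃(μ_p) > 0` at EVERY interior `p` (the tree had `≥ 0` everywhere and
`≠ 0` somewhere). [this work] -/
theorem sahiE_three_ind_pos_of_faceVanishing (ι : Type) [Fintype ι] (p : ι → unitInterval)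
    (hp : ∀ e, (p e : ℝ) ∈ Set.Ioo (0 : ℝ) 1) (U : Fin 3 → Set (Set ι)) (S : Finset ι) (hU : ∀ j, IsUpperSet (U j))
    (hUS : ∀ j, DeterminedBy (U j) (↑S : Set ι)) (hfv : ∀ e ∈ S, ∀ b : Bool, SuppZeroFlag 3 (fun j => secAt e b (U j)))
    (hZ : ¬ SuppZeroFlag 3 U) : 0 < sahiE (bernoulliWeight p) 3 (fun j => ind (U j)) :=
  sahiE_ind_pos_of_combPos hU (combPos_sahiE_three_of_faceVanishing ι U S hU hUS hfv) hZ hp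

/-- Density-free zeros on the face-vanishing class (closed cube). [this work] -/
theorem sahiE_three_ind_eq_zero_of_interior_zero_of_faceVanishing (ι : Type) [Fintype ι] (U : Fin 3 → Set (Set ι))
    (S : Finset ι) (hU : ∀ j, IsUpperSet (U j)) (hUS : ∀ j, DeterminedBy (U j) (↑S : Set ι))
    (hfv : ∀ e ∈ S, ∀ b : Bool, SuppZeroFlag 3 (fun j => secAt e b (U j))) {q : ι → unitInterval}
    (hq : ∀ e, (q e : ℝ) ∈ Set.Ioo (0 : ℝ) 1) (h0 : sahiE (bernoulliWeight q) 3 (fun j => ind (U j)) = 0)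
    (p : ι → unitInterval) : sahiE (bernoulliWeight p) 3 (fun j => ind (U j)) = 0 :=
  (combPos_sahiE_three_of_faceVanishing ι U S hU hUS hfv).eq_zero_of_interior hq h0 p

end Pointwise

end Summit.CriticalPhenomena.PercolationContinuityZ3.Theorems
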